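import Mathlib
import HarnessLib
import Summits.CriticalPhenomena.PercolationContinuityZ3.Theses.PercBurnResprinkle

/-!
# Sketch2 (ideator 2) — crux VacantSetPercolates (stmt-CriticalPhenomena-7205), crux-ideate round 1, ideator 2

First-lemma signatures for the crux idea cards
* `planar-armed-sections`  (transfer to a planar finite-size criterion at `p_c`),
* `fragile-cage-seams`     (slab-fragility × two-arm sparsity against dense cages).
Nothing here is proved; every `def` is a `Prop` over existing declarations and every
`theorem` is a `sorry`d signature that must elaborate.
-/

namespace Summit.CriticalPhenomena.PercolationContinuityZ3.Cruxes.VacantSetPercolates.Sketch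

open Literature.Probability.Percolation Literature.Probability.LatticeModels
open MeasureTheory

noncomputable section

/-- The cubic lattice `ℤ³`. -/
abbrev Z3 : SimpleGraph (Site 3) := zdGraph 3

/-- `p_c(ℤ³)` as a real number (bond, nearest neighbour). -/
def pc : ℝ := criticalProb Z3 (0 : Site 3)

/-- The sup-norm ball of radius `n` about `x`. -/
def ball (x : Site 3) (n : ℕ) : Set (Site 3) := {z | ∀ i, |z i - x i| ≤ n}

/-- Its inner vertex boundary (some coordinate at sup-distance exactly `n`). -/
def ballBdry (x : Site 3) (n : ℕ) : Set (Site 3) := {z | z ∈ ball x n ∧ ∃ i, |z i - x i| = n}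

/-- LOCAL arm event: `x` is joined to the boundary of `x + B(n)` by an open path inside the box.
It is measurable w.r.t. the edges of the box (2n-dependent as a site process) and it CONTAINS the
event `x ∈ I(ω)` (an infinite cluster leaves every box). Its complement is the local vacant proxy
`V⁽ⁿ⁾ ⊆ V = {x : C(x) finite}` of Grimmett–Holroyd–Kozma (arXiv:1303.1657, proof of Thm 5: `Bₙ ∖ Rₙ`). -/
def ArmedIn (n : ℕ) (ω : BondConfig (Site 3)) (x : Site 3) : Prop :=
  ∃ y ∈ ballBdry x n, ω ∈ openConnIn (ball x n) x y

/-- The vacant set of the configuration: vertices whose open cluster is finite. -/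
def vacant (ω : BondConfig (Site 3)) : Set (Site 3) := {x | ¬ (openCluster ω x).Infinite}

/-- Lattice connectivity INSIDE a vertex set `S` (all lattice edges allowed): `x ↔ y in S`,
expressed with the tree's `openConnIn` at the full configuration `E(ℤ³)`. -/
def latticeConnIn (S : Set (Site 3)) (x y : Site 3) : Prop := Z3.edgeSet ∈ openConnIn S x y

/-! ## Card `planar-armed-sections` -/

/-- The planar rectangle `[0,3N] × [0,N] × {0}`. -/
def rect (N : ℕ) : Set (Site 3) := {z | z 2 = 0 ∧ 0 ≤ z 0 ∧ z 0 ≤ 3 * N ∧ 0 ≤ z 1 ∧ z 1 ≤ N}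

/-- LOCAL planar event `E(n,N)`: the rectangle is crossed in the long direction, inside the plane
`{x₃ = 0}`, by a lattice path of vertices NONE of which is armed to distance `n`. Depends only on
edges within distance `n` of the rectangle. -/
def RectVacantCrossed (n N : ℕ) (ω : BondConfig (Site 3)) : Prop :=
  ∃ x y : Site 3, x 0 = 0 ∧ y 0 = 3 * N ∧
    latticeConnIn {z | z ∈ rect N ∧ ¬ ArmedIn n ω z} x y

/-- PLANAR ARMED-CROSSING FINITE-SIZE CRITERION AT CRITICALITY (the transfer target `C⁺` of the
card): at ONE pair of scales `10 n ≤ N`, at the single parameter `p_c(ℤ³)`, long planar vacant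
crossings by un-armed vertices have probability at least `7/8` (the constant of 1-dependent planar
comparison, Balister–Bollobás–Walters 0.8639 < 7/8). Equivalently (planar duality): a top–bottom
`*`-path of `n`-ARMED vertices across the rectangle has probability `≤ 1/8`. -/
def PlanarArmedFSC : Prop :=
  ∃ n N : ℕ, 1 ≤ n ∧ 10 * n ≤ N ∧
    (7 : ℝ) / 8 ≤ (bondPercolation Z3 (criticalProbI 3)).real {ω | RectVacantCrossed n N ω}

/-- FIRST LEMMA of `planar-armed-sections` (claimed provable now, size M): the planar criterion at
`p_c` implies the crux. Route: continuity in `p` of the local event `RectVacantCrossed n N`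
⇒ same bound `≥ 7/8 − η` at some `p > p_c`; the un-armed planar site process at that `p` is
`2n`-dependent, so horizontal/vertical `3N × N` rectangle crossings form a 1-dependent bond model
on a renormalised `ℤ²` with marginals `> 0.8639` ⇒ it percolates (Balister–Bollobás–Walters 2005) ⇒
the plane `{x₃=0}` contains an infinite lattice path of un-armed, hence vacant, vertices ⇒ the
vacant set percolates at that `p > p_c` ⇒ positivity at the origin by translation invariance and a
countable union. -/
theorem vacantSetPercolates_of_planarArmedFSC :
    PlanarArmedFSC → Theses.PercBurnResprinkle.VacantSetPercolates := by
  sorry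

/-- The RSW upgrade available for free (Köhler-Schindler–Tassion, arXiv:2011.04618 Thm 1, valid
for every translation/rotation/reflection-invariant positively associated planar site process; the
armed field `x ↦ ArmedIn n ω x` restricted to a coordinate plane is one): if the criterion FAILS at
every scale then `n`-armed `*`-CIRCUITS surround the origin in the planar annulus
`A(N,3N) × {0}` with probability bounded below, at every scale `N = 10 n`. Recorded as the
structural consequence a refutation of `PlanarArmedFSC` must live with. -/
def ArmedPlanarCircuits : Prop :=
  ∃ c : ℝ, 0 < c ∧ ∀ n : ℕ, 1 ≤ n →
    c ≤ (bondPercolation Z3 (criticalProbI 3)).real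
      {ω | ∃ γ : Set (Site 3), γ ⊆ {z | z 2 = 0 ∧ ArmedIn n ω z} ∧
        (∀ z ∈ γ, (10 * n : ℤ) ≤ max |z 0| |z 1| ∧ max |z 0| |z 1| ≤ 30 * n) ∧
        -- γ *-separates the inner square from infinity inside the plane:
        ∀ x y : Site 3, x 2 = 0 → y 2 = 0 → max |x 0| |x 1| < 10 * n → 30 * n < max |y 0| |y 1| →
          ¬ latticeConnIn {z | z 2 = 0 ∧ z ∉ γ} x y}

theorem armedPlanarCircuits_of_not_fsc : ¬ PlanarArmedFSC → ArmedPlanarCircuits := by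
  sorry

/-! ## Card `fragile-cage-seams` -/

/-- The horizontal slab `{|x₃| ≤ L}` as an edge set of `ℤ³` (both endpoints in the slab). -/
def slabEdges (L : ℕ) : BondConfig (Site 3) := {e | e ∈ Z3.edgeSet ∧ ∀ z ∈ e, |z 2| ≤ L}

/-- Bond TWO-ARMS event at scale `n` from the lattice-adjacent pair `(x, y)`: inside the box
`x + B(n)` the vertices `x` and `y` are NOT joined by an open path, yet each is joined inside the
box to its boundary (two disjoint box-clusters both reaching distance `n`; the event `A₂ᵉ(n)` of
Aizenman–Kesten–Newman 1987 / Cerf arXiv:1306.3105 / Duminil-Copin–Ioffe–Velenik Thm 2.1, in the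
box-restricted form used by card two-arms-exponent-amplifier). -/
def TwoArmsAt (n : ℕ) (ω : BondConfig (Site 3)) (x y : Site 3) : Prop :=
  ω ∉ openConnIn (ball x n) x y ∧ (∃ u ∈ ballBdry x n, ω ∈ openConnIn (ball x n) x u) ∧
    (∃ v ∈ ballBdry x n, ω ∈ openConnIn (ball x n) y v)

/-- SEAM LEMMA (first lemma of `fragile-cage-seams`; deterministic, claimed provable now, S):
two adjacent vertices of the mid-plane which both lie in infinite open clusters of `ω` but in
DIFFERENT open clusters of the slab-restricted configuration `ω ∩ slabEdges L` realise the two-arms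
event at scale `L` (the box `x + B(L)` lies inside the slab, so a connection inside the box would be
a slab connection; each infinite cluster leaves the box). Seams of a cage inside a non-percolating
slab are two-arm points. -/
theorem twoArms_of_seam (L : ℕ) (hL : 1 ≤ L) (ω : BondConfig (Site 3)) (hω : ω ⊆ Z3.edgeSet)
    (x y : Site 3) (hx0 : x 2 = 0) (hxy : Z3.Adj x y)
    (hx : (openCluster ω x).Infinite) (hy : (openCluster ω y).Infinite)
    (hsep : y ∉ openCluster (ω ∩ slabEdges L) x) :
    TwoArmsAt L ω x y := by
  sorry

/-- The exponent crux the card shares with card two-arms-exponent-amplifier (there `T(γ₂)`), here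
needed on a right-neighbourhood of `p_c`: two-arms decay with SOME exponent `a > 1`
(AKN/Cerf give `1/2` and `12/23`; Duminil-Copin–Ioffe–Velenik Thm 2.3 gives `3/2` granted bounded
variance of the number of annulus-crossing clusters; conjecturally `a = 3 − 1/ν ≈ 1.86`). -/
def TwoArmDecay : Prop :=
  ∃ C a δ : ℝ, 1 < a ∧ 0 < δ ∧ ∀ p : unitInterval, pc ≤ (p : ℝ) → (p : ℝ) ≤ pc + δ →
    ∀ n : ℕ, 1 ≤ n → ∀ y : Site 3, Z3.Adj 0 y →
      (bondPercolation Z3 p).real {ω | TwoArmsAt n ω 0 y} ≤ C * (n : ℝ) ^ (-a)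

/-- SLAB FRAGILITY (known: Grimmett–Marstrand 1990 `p_c(S_L) ↓ p_c` with Aizenman–Grimmett
strictness `p_c(S_L) > p_c`; hence for `p` close to `p_c` slabs of every thickness up to
`L(p) → ∞` do not percolate). Stated as the input the card consumes. -/
def SlabFragility : Prop :=
  ∀ L : ℕ, ∃ δ : ℝ, 0 < δ ∧ ∀ p : unitInterval, (p : ℝ) ≤ pc + δ →
    ∀ x : Site 3, bondPercolation Z3 p {ω | (openCluster (ω ∩ slabEdges L) x).Infinite} = 0

end

end Summit.CriticalPhenomena.PercolationContinuityZ3.Cruxes.VacantSetPercolates.Sketch
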